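import Summits.NavierStokesRegularity.NavierStokesRegularity.Theses.RellichScar
import Summits.NavierStokesRegularity.NavierStokesRegularity.Theorems.ScarRigidity.Negative.LogicAndLoadBearing
import HarnessLib

/-!
# drefute / line `finite-energy-log-convexity` — the residual stub S5 is the WHOLE crux

Finding (refuter-drefute-stmt-NavierStokesRegularity-11717-0, 2026-08-16):
the lead's residual stub

  `stub_noAnomalousExtinction : ∀ C : ℝ, 1 ≤ 2 * C ^ 2 → ScarRigidityAt C`

is *logically equivalent* to `RellichScar.ScarRigidity` itself (`stub5_iff_scarRigidity`), because the
slices `ScarRigidityAt C` are ANTITONE in `C` (`scarRigidityAt_anti`, Negative/LogicAndLoadBearing): the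
Type-I constant is only an upper bound, so every apex pair with constant `C₀` is also an apex pair with
constant `max C₀ 1 ≥ 1/√2`.  Consequently the case split in the skeleton's `ScarRigidity_of` is dead code:
the sub-threshold branch (S1α, S1β, S1b, S2, S4) is never needed to close the crux
(`scarRigidity_of_stub5`), and the "residual handed back" is not "the crux above `1/√2`" but the crux.

The HONEST residual restricts to pairs that admit NO common sub-threshold constant
(`AboveThresholdSharp`); with it the decomposition `ScarRigidity ↔ BelowThreshold ∧ AboveThresholdSharp`
(`scarRigidity_iff_below_and_aboveSharp`) is a genuine partition of the pairs, and `BelowThreshold` is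
exactly what S1α–S4 deliver (even without the singularity hypotheses).
-/

noncomputable section

open Set Filter Function MeasureTheory Metric TopologicalSpace
open scoped Topology ENNReal NNReal
open Literature.Analysis.FluidPDE
open Summit.NavierStokesRegularity.NavierStokesRegularity.Theses.RellichScar
open Summit.NavierStokesRegularity.NavierStokesRegularity.Theorems.ScarRigidity.Negative

namespace Refuter.Drefute.FELC.S5

/-- Physical space. -/
local notation "ℝ³" => EuclideanSpace ℝ (Fin 3)

/-- The open backward slab `(-∞,0) × ℝ³` (time first). -/
local notation "𝕊" => Literature.Analysis.FluidPDE.slab (EuclideanSpace ℝ (Fin 3)) (Set.Iio (0 : ℝ)) isOpen_Iio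

/-- The lead's residual stub S5, verbatim (Lines/finite-energy-log-convexity.lean). -/
def Stub5 : Prop := ∀ C : ℝ, 1 ≤ 2 * C ^ 2 → ScarRigidityAt C

/-- `1 ≤ 2 (max C 1)²`. -/
theorem one_le_two_mul_sq_max (C : ℝ) : 1 ≤ 2 * (max C 1) ^ 2 := by
  have hm : 1 ≤ max C 1 := le_max_right C 1
  nlinarith [mul_nonneg (sub_nonneg.2 hm) (by linarith : (0 : ℝ) ≤ max C 1 + 1)]

/-- **S5 alone proves the crux** (no other stub of the line is used): given a pair at constant `C`,
apply S5 at `max C 1` and come back down with `scarRigidityAt_anti`. -/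
theorem scarRigidity_of_stub5 (h : Stub5) : ScarRigidity := by
  rw [scarRigidity_iff_forall_at]
  intro C
  exact scarRigidityAt_anti (le_max_left C 1) (h _ (one_le_two_mul_sq_max C))

/-- Conversely the crux gives S5 (drop the threshold hypothesis). -/
theorem stub5_of_scarRigidity (h : ScarRigidity) : Stub5 := fun C _ =>
  (scarRigidity_iff_forall_at.1 h) C

/-- **S5 ⟺ crux.** The threshold hypothesis `1 ≤ 2C²` is inert. -/
theorem stub5_iff_scarRigidity : Stub5 ↔ ScarRigidity :=
  ⟨scarRigidity_of_stub5, stub5_of_scarRigidity⟩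

/-! ## The honest decomposition -/

/-- The sub-threshold slices (what S1α–S4 of the line deliver, with singular hypotheses to spare). -/
def BelowThreshold : Prop := ∀ C : ℝ, 2 * C ^ 2 < 1 → ScarRigidityAt C

/-- The HONEST residual: the crux restricted to pairs admitting no common sub-threshold Type-I
constant (then `1 ≤ 2C²` is automatic for every admissible `C`, so it is not repeated). -/
def AboveThresholdSharp : Prop :=
  ∀ (u₁ : ℝ → ℝ³ → ℝ³) (p₁ : ℝ → ℝ³ → ℝ) (G₁ : ℝ → ℝ³ → ℝ³ →L[ℝ] ℝ³)
    (u₂ : ℝ → ℝ³ → ℝ³) (p₂ : ℝ → ℝ³ → ℝ) (G₂ : ℝ → ℝ³ → ℝ³ →L[ℝ] ℝ³) (C : ℝ),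
    IsSuitableWeakSolutionOn 𝕊 1 0 u₁ p₁ → HasWeakSpatialGradientOn 𝕊 u₁ G₁ →
    typeIBound (Iio (0 : ℝ) ×ˢ univ) u₁ p₁ G₁ < ⊤ → HasTypeIDecay C u₁ →
    IsSuitableWeakSolutionOn 𝕊 1 0 u₂ p₂ → HasWeakSpatialGradientOn 𝕊 u₂ G₂ →
    typeIBound (Iio (0 : ℝ) ×ˢ univ) u₂ p₂ G₂ < ⊤ → HasTypeIDecay C u₂ →
    IsBackwardSingularPoint u₁ 0 → IsBackwardSingularPoint u₂ 0 →
    (∀ C' : ℝ, 2 * C' ^ 2 < 1 → ¬ (HasTypeIDecay C' u₁ ∧ HasTypeIDecay C' u₂)) →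
    SameScar u₁ u₂ → AeEqSlab u₁ u₂

/-- Under the sharp residual's extra hypothesis the threshold inequality for `C` is automatic. -/
theorem one_le_of_noSubthreshold {C : ℝ} {u₁ u₂ : ℝ → ℝ³ → ℝ³}
    (hd₁ : HasTypeIDecay C u₁) (hd₂ : HasTypeIDecay C u₂)
    (hmin : ∀ C' : ℝ, 2 * C' ^ 2 < 1 → ¬ (HasTypeIDecay C' u₁ ∧ HasTypeIDecay C' u₂)) :
    1 ≤ 2 * C ^ 2 := by
  by_contra h
  exact hmin C (not_le.1 h) ⟨hd₁, hd₂⟩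

/-- **Honest partition of the crux**: sub-threshold slices plus the sharp residual. -/
theorem scarRigidity_iff_below_and_aboveSharp :
    ScarRigidity ↔ BelowThreshold ∧ AboveThresholdSharp := by
  constructor
  · intro h
    refine ⟨fun C _ => (scarRigidity_iff_forall_at.1 h) C, ?_⟩
    intro u₁ p₁ G₁ u₂ p₂ G₂ C hs₁ hg₁ hI₁ hd₁ hs₂ hg₂ hI₂ hd₂ hsing₁ hsing₂ _ hscar
    exact h u₁ p₁ G₁ u₂ p₂ G₂ C hs₁ hg₁ hI₁ hd₁ hs₂ hg₂ hI₂ hd₂ hsing₁ hsing₂ hscar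
  · rintro ⟨hbelow, habove⟩
    intro u₁ p₁ G₁ u₂ p₂ G₂ C hs₁ hg₁ hI₁ hd₁ hs₂ hg₂ hI₂ hd₂ hsing₁ hsing₂ hscar
    by_cases hsub : ∃ C' : ℝ, 2 * C' ^ 2 < 1 ∧ HasTypeIDecay C' u₁ ∧ HasTypeIDecay C' u₂
    · obtain ⟨C', hC', hd₁', hd₂'⟩ := hsub
      exact hbelow C' hC' u₁ p₁ G₁ u₂ p₂ G₂ hs₁ hg₁ hI₁ hd₁' hs₂ hg₂ hI₂ hd₂' hsing₁ hsing₂ hscar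
    · push Not at hsub
      exact habove u₁ p₁ G₁ u₂ p₂ G₂ C hs₁ hg₁ hI₁ hd₁ hs₂ hg₂ hI₂ hd₂ hsing₁ hsing₂
        (fun C' hC' h2 => hsub C' hC' h2.1 h2.2) hscar

/-- The sharp residual is implied by the lead's S5 (so nothing is lost by sharpening)… -/
theorem aboveSharp_of_stub5 (h : Stub5) : AboveThresholdSharp := by
  intro u₁ p₁ G₁ u₂ p₂ G₂ C hs₁ hg₁ hI₁ hd₁ hs₂ hg₂ hI₂ hd₂ hsing₁ hsing₂ hmin hscar
  exact h C (one_le_of_noSubthreshold hd₁ hd₂ hmin) u₁ p₁ G₁ u₂ p₂ G₂ hs₁ hg₁ hI₁ hd₁ hs₂ hg₂ hI₂ hd₂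
    hsing₁ hsing₂ hscar

/-- … and, together with the sub-threshold theorem, gives it back: the corrected skeleton composes. -/
theorem stub5_of_below_and_aboveSharp (hb : BelowThreshold) (ha : AboveThresholdSharp) : Stub5 :=
  stub5_of_scarRigidity (scarRigidity_iff_below_and_aboveSharp.2 ⟨hb, ha⟩)

end Refuter.Drefute.FELC.S5

end
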